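import Summits.HubbardSuperconductivity.HubbardSuperconductivity.Theorems.LevyLogBootstrapHalfFilledOrderBridge
import Literature.MathematicalPhysics.QuantumLattice.XYZGroundStateOrderWMHWindow
import HarnessLib

/-!
# Half-filled planar order on the Wischmann–Müller-Hartmann window `Δ ∈ [-0.22, 0]`, UNCONDITIONAL

Support file for the hub `HalfFilledOrder` (`stmt-HubbardSuperconductivity-0906`), sequel of
`LevyLogBootstrapHalfFilledOrderWindow015.lean` (window `[-0.15, 0]`) and of the CONDITIONAL
Wischmann–Müller-Hartmann section of `LevyLogBootstrapHalfFilledOrderBridge.lean`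
(`halfFilledOrder_wmhWindow`, `halfFilledOrder_iff_hasEvenTorusLRO_deep_of_wmh`, both taking the
vendored named fact `wischmannMullerHartmann1991_ground_lro_spinHalf` as a hypothesis). The named
fact is now a THEOREM of the tree: `wischmannMullerHartmann1991_ground_lro_spinHalf_holds`
(`Literature/MathematicalPhysics/QuantumLattice/XYZGroundStateOrderWMHWindow.lean`, hubbard-cq-lit-1:
W–MH §2 eq. (8) two-sum-rule mixing with weight `3/10`, the IR bound and orbit inequalities, a
degree-16 polynomial majorant certified by 21 kernel-checked Bernstein pieces; spin-½ XXZ planar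
ground-state LRO on `ℤ²` for ALL `0 ≤ Δ_AF ≤ 0.22`). This file discharges the hypothesis — three
one-line consequences, nothing else:

* `halfFilledOrder_window022` — the hub's SECTOR-form planar floor `c(Δ)·M⁴ ≤ Re⟨ψ, S⁺_tot S⁻_tot ψ⟩`
  for every normalised `S³_tot = 0` sector ground state on large even tori, for EVERY
  `Δ ∈ [-0.22, 0]`, UNCONDITIONALLY (was `[-0.15, 0]`);
* `halfFilledOrder_iff_hasEvenTorusLRO_deep022` — what is open, in Literature vocabulary: the hub is
  equivalent to tracial planar LRO of `anisotropicTorus 2 L 1 1 Δ 1` on the deep interval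
  `Δ ∈ (-1, -0.22)` only;
* `halfFilledOrder_of_deepWindow022` — the residue in sector form: `HalfFilledOrder` follows from
  its restriction to `Δ ∈ (-1, -0.22)`.

No definition, no named fact, no `sorry`; the hub itself (all of `(-1, 0]`) stays OPEN.

References: H. A. Wischmann, E. Müller-Hartmann, J. Phys. I France 1 (1991) 647, Abstract and §5;
T. Kennedy, E. H. Lieb, B. S. Shastry, J. Stat. Phys. 53 (1988) 1019; K. Kubo, T. Kishi,
Phys. Rev. Lett. 61 (1988) 2585; J. E. Björnberg, D. Ueltschi, arXiv:2204.12896 (2022), Thm 3.2.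
-/

-- the mandated namespace `Summit.<Summit>.<Problem>.Theorems` repeats `HubbardSuperconductivity`
set_option linter.dupNamespace false

noncomputable section

namespace Summit.HubbardSuperconductivity.HubbardSuperconductivity.Theorems.LevyLogBootstrap

open Matrix Finset Filter Complex
open Literature.MathematicalPhysics.QuantumLattice Literature.Probability.LatticeModels
open Summit.HubbardSuperconductivity.HubbardSuperconductivity.Theses.LevyLogBootstrap

/-- **Half-filled sector order on the Wischmann–Müller-Hartmann window `Δ ∈ [-0.22, 0]`,
UNCONDITIONAL**: for every such `Δ` there are `c > 0` and `M₀` such that every normalised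
`S³_tot = 0` sector ground state `ψ` of `xxzHamiltonian 1 (torusGraph 2 M) (-1) Δ` on an even torus
`M ≥ M₀` has `c·M⁴ ≤ Re⟨ψ, S⁺_tot S⁻_tot ψ⟩` — `halfFilledOrder_wmhWindow` applied to the discharged
fact `wischmannMullerHartmann1991_ground_lro_spinHalf_holds`.
[cite: WischmannMullerhartmann1991, Abstract (p. 647) and §5 (pp. 654–655, Table I)] -/
theorem halfFilledOrder_window022 :
    ∀ Δ ∈ Set.Icc (-0.22 : ℝ) 0, ∃ c : ℝ, 0 < c ∧ ∃ M₀ : ℕ, ∀ (M : ℕ) [NeZero M], Even M →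
      M₀ ≤ M → ∀ (ψ : TensorIndex (TorusSite 2 M) 2 → ℂ),
      ψ ∈ spinZSector (Λ := TorusSite 2 M) 1 0 → star ψ ⬝ᵥ ψ = 1 →
      Matrix.mulVec (xxzHamiltonian 1 (torusGraph 2 M) (-1) Δ) ψ =
        ((lowestEnergyInSector 1 (xxzHamiltonian 1 (torusGraph 2 M) (-1) Δ) 0 : ℝ) : ℂ) • ψ →
      c * (M : ℝ) ^ 4 ≤ (star ψ ⬝ᵥ Matrix.mulVec
        ((∑ x : TorusSite 2 M, onSite x (spinRaise 1)) *
          (∑ y : TorusSite 2 M, onSite y (spinLower 1))) ψ).re :=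
  halfFilledOrder_wmhWindow wischmannMullerHartmann1991_ground_lro_spinHalf_holds

/-- **What is open, in Literature vocabulary (unconditional form)**: since the window `[-0.22, 0]`
is now proved, the hub `HalfFilledOrder` is EQUIVALENT to tracial planar LRO of
`anisotropicTorus 2 L 1 1 Δ 1` for every `Δ` in the deep easy-plane interval `(-1, -0.22)` —
`halfFilledOrder_iff_hasEvenTorusLRO_deep_of_wmh` at the discharged fact.
[cite: WischmannMullerhartmann1991, Abstract (p. 647) and §5 (pp. 654–655, Table I)] -/
theorem halfFilledOrder_iff_hasEvenTorusLRO_deep022 :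
    HalfFilledOrder ↔ ∀ Δ ∈ Set.Ioo (-1 : ℝ) (-0.22),
      HasEvenTorusLRO (fun L x y => groundStateAxisCorrTorus (d := 2) L 1 1 Δ 1 x y) :=
  halfFilledOrder_iff_hasEvenTorusLRO_deep_of_wmh wischmannMullerHartmann1991_ground_lro_spinHalf_holds

/-- **What is left of `HalfFilledOrder` after the Wischmann–Müller-Hartmann window** (sector form):
the hub statement holds as soon as it holds on the deep easy-plane interval `Δ ∈ (-1, -0.22)`
(was `(-1, -0.15)`, `halfFilledOrder_of_deepWindow015`). [folklore] -/
theorem halfFilledOrder_of_deepWindow022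
    (hdeep : ∀ Δ ∈ Set.Ioo (-1 : ℝ) (-0.22), ∃ c : ℝ, 0 < c ∧ ∃ M₀ : ℕ, ∀ (M : ℕ) [NeZero M],
      Even M → M₀ ≤ M → ∀ (ψ : TensorIndex (TorusSite 2 M) 2 → ℂ),
      ψ ∈ spinZSector (Λ := TorusSite 2 M) 1 0 → star ψ ⬝ᵥ ψ = 1 →
      Matrix.mulVec (xxzHamiltonian 1 (torusGraph 2 M) (-1) Δ) ψ =
        ((lowestEnergyInSector 1 (xxzHamiltonian 1 (torusGraph 2 M) (-1) Δ) 0 : ℝ) : ℂ) • ψ →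
      c * (M : ℝ) ^ 4 ≤ (star ψ ⬝ᵥ Matrix.mulVec
        ((∑ x : TorusSite 2 M, onSite x (spinRaise 1)) *
          (∑ y : TorusSite 2 M, onSite y (spinLower 1))) ψ).re) :
    HalfFilledOrder := by
  intro Δ hΔ
  by_cases hw : -0.22 ≤ Δ
  · exact halfFilledOrder_window022 Δ ⟨hw, hΔ.2⟩
  · exact hdeep Δ ⟨hΔ.1, lt_of_not_ge hw⟩

end Summit.HubbardSuperconductivity.HubbardSuperconductivity.Theorems.LevyLogBootstrap

end
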